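import Summits.KontsevichZagierPeriods.KontsevichZagierPeriods.Theorems.RootDecompZetaThreeFrontierWordMatchPreludeP13

/-! # `RootDecompZetaThreeFrontierWordMatchPreludeP14` — part 6/6 of the mechanical ≤340-line split of `src.lean`
(split by the decomp-kz census seat for landing; mathematics unchanged; part 6 continues part 5). -/

set_option linter.dupNamespace false

noncomputable section

namespace Summit.KontsevichZagierPeriods.RootDecompZetaThreeFrontier.WordLayer
open Set MeasureTheory Literature.NumberTheory.Transcendental MvPolynomial
open Summit.KontsevichZagierPeriods.KontsevichZagierPeriods.Theorems.RootDecompZetaThreeFrontierWordMoves (mem_simplex_three_iff)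

section RuleD6

/-- **the D6 remainder as six scaled gap classes** (short-Q law, NODE.md ADDENDUM 10), on `Δ₃°` -/
theorem ruleD6_identity {t : Fin 3 → ℝ} (ht : t ∈ KZ.openOrderedSimplex 3) (κ : Fin 4 →₀ ℕ) (q : ℚ) (a β₀ β₁ γ₁ : ℕ) (ha : 1 ≤ a) :
    layerF (toT (gR2Q (monomial κ q) 0 0 a)) β₀ β₁ γ₁ 1 a t =
      ((q * (κ 2 : ℕ) / a : ℚ) : ℝ) * gapF κ β₀ β₁ γ₁ 1 a t + ((q * (κ 2 : ℕ) / a : ℚ) : ℝ) * gapF (gshift κ 1 2) β₀ β₁ γ₁ 1 a t +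
        ((q * (κ 2 : ℕ) / a : ℚ) : ℝ) * gapF (gshift κ 0 2) β₀ β₁ γ₁ 1 a t -
      (((q * (κ 3 : ℕ) / a : ℚ) : ℝ) * gapF (gshift κ 2 3) β₀ β₁ γ₁ 1 a t + ((q * (κ 3 : ℕ) / a : ℚ) : ℝ) * gapF (gshift κ 1 3) β₀ β₁ γ₁ 1 a t +
        ((q * (κ 3 : ℕ) / a : ℚ) : ℝ) * gapF (gshift κ 0 3) β₀ β₁ γ₁ 1 a t) := by
  obtain ⟨h0, h1, h1', h2', hδ⟩ := simplex3_facts ht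
  have g0 := gaps_ne_zero ht 0
  have g1 := gaps_ne_zero ht 1
  have g2 := gaps_ne_zero ht 2
  have g3 := gaps_ne_zero ht 3
  simp only [gaps_zero, gaps_one, gaps_two, gaps_three] at g0 g1 g2 g3
  have haR : (a : ℝ) ≠ 0 := by exact_mod_cast (by omega : a ≠ 0)
  rw [layerF_toT_gR2Q_monomial_zero ht]
  simp only [gapF_eq_gmon_div]
  push_cast
  have resh : ∀ (c D G : ℝ) (n : ℕ), (q : ℝ) * (n : ℝ) / (a : ℝ) * (G / D) = (q : ℝ) / a * ((n : ℝ) * G) / D := fun c D G n => by ring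
  rw [resh 0 _ (gmon (gshift κ 1 2) t), resh 0 _ (gmon (gshift κ 0 2) t), resh 0 _ (gmon (gshift κ 2 3) t),
    resh 0 _ (gmon (gshift κ 1 3) t), resh 0 _ (gmon (gshift κ 0 3) t),
    natCast_mul_gmon_gshift ht κ 1 2 (by decide), natCast_mul_gmon_gshift ht κ 0 2 (by decide),
    natCast_mul_gmon_gshift ht κ 2 3 (by decide), natCast_mul_gmon_gshift ht κ 1 3 (by decide),
    natCast_mul_gmon_gshift ht κ 0 3 (by decide)]
  simp only [gaps_zero, gaps_one, gaps_two, gaps_three]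
  field_simp
  ring

end RuleD6

end Summit.KontsevichZagierPeriods.RootDecompZetaThreeFrontier.WordLayer

namespace Summit.KontsevichZagierPeriods.KontsevichZagierPeriods.Cruxes.GZNormalFormWThree.GZLadder

open Set MeasureTheory Literature.NumberTheory.Transcendental
open Summit.KontsevichZagierPeriods.RootDecompZetaThreeFrontier
open Summit.KontsevichZagierPeriods.KontsevichZagierPeriods.Theorems.RootDecompZetaThreeFrontierWordMoves (measurableSet_simplex)

/-- **RULE D6 of the short-Q law, PROVED** (the exemplar rule of the `GapClassMatch` induction): a scaled admissible gap class with
`γ₂ = 0`, `α = a+1 ≥ 2` (and `β₁ ≤ 1`, which holds whenever D6 fires) is congruent into the target as soon as EVERY scaled admissible gap class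
over the lowered exponent vector `(β₀,β₁,γ₁,1,a)` is (`μ` drops in its first key).  Proof: `lowerT2G` with `H = q·g^κ`, `Q = 0`, the remainder
being the six classes of `ruleD6_identity`, packaged by `sum_pack3`. -/
theorem ruleD6 (κ : Fin 4 →₀ ℕ) (q : ℚ) (β₀ β₁ γ₁ a : ℕ) (ha : 1 ≤ a) (hβ₁ : β₁ ≤ 1)
    (hV0 : β₀ + β₁ + (a + 1) ≤ κ 1 + κ 2 + κ 3 + 2) (hB1 : β₁ ≤ κ 2 + κ 3 + 1) (hAl : a + 1 ≤ κ 1 + κ 2 + 1)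
    (hC1 : γ₁ ≤ κ 0 + κ 1 + 1) (hV3 : γ₁ + (a + 1) ≤ κ 0 + κ 1 + κ 2 + 2)
    (IH : ∀ (q' : ℚ) (κ' : Fin 4 →₀ ℕ), β₀ + β₁ + a ≤ κ' 1 + κ' 2 + κ' 3 + 2 → β₁ ≤ κ' 2 + κ' 3 + 1 → a ≤ κ' 1 + κ' 2 + 1 →
      γ₁ ≤ κ' 0 + κ' 1 + 1 → 1 + γ₁ + a ≤ κ' 0 + κ' 1 + κ' 2 + 2 → ∀ s : KZ.IntegralRep 3, s.domain = simplex 3 →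
      EqOn s.integrand (fun t => (q' : ℝ) * WordLayer.gapF κ' β₀ β₁ γ₁ 1 a t) s.domain → CongInto (layerThree ∪ gzLETwo) (KZ.of s))
    (r : KZ.IntegralRep 3) (hd : r.domain = simplex 3)
    (hi : EqOn r.integrand (fun t => (q : ℝ) * WordLayer.gapF κ β₀ β₁ γ₁ 0 (a + 1) t) r.domain) :
    CongInto (layerThree ∪ gzLETwo) (KZ.of r) := by
  -- the six pieces
  let cs : Fin 6 → ℚ := ![q * (κ 2 : ℕ) / a, q * (κ 2 : ℕ) / a, q * (κ 2 : ℕ) / a, -(q * (κ 3 : ℕ) / a), -(q * (κ 3 : ℕ) / a),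
    -(q * (κ 3 : ℕ) / a)]
  let ks : Fin 6 → (Fin 4 →₀ ℕ) := ![κ, WordLayer.gshift κ 1 2, WordLayer.gshift κ 0 2, WordLayer.gshift κ 2 3, WordLayer.gshift κ 1 3,
    WordLayer.gshift κ 0 3]
  have hadm : ∀ j : Fin 6, β₀ + β₁ + a ≤ ks j 1 + ks j 2 + ks j 3 + 2 ∧ β₁ ≤ ks j 2 + ks j 3 + 1 ∧ a ≤ ks j 1 + ks j 2 + 1 ∧
      γ₁ ≤ ks j 0 + ks j 1 + 1 ∧ 1 + γ₁ + a ≤ ks j 0 + ks j 1 + ks j 2 + 2 := by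
    intro j
    fin_cases j <;> simp [ks, WordLayer.gshift] <;> omega
  have hsum : ∀ z ∈ KZ.openOrderedSimplex 3, WordLayer.layerF (WordLayer.toT (WordLayer.gR2Q (MvPolynomial.monomial κ q) 0 0 a)) β₀ β₁ γ₁ 1 a z =
      ∑ j ∈ (Finset.univ : Finset (Fin 6)), (cs j : ℝ) * WordLayer.gapF (ks j) β₀ β₁ γ₁ 1 a z := by
    intro z hz
    rw [WordLayer.ruleD6_identity hz κ q a β₀ β₁ γ₁ ha, Fin.sum_univ_six]
    simp only [cs, ks, Matrix.cons_val_zero, Matrix.cons_val_one, Matrix.head_cons, Matrix.cons_val_two, Matrix.tail_cons,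
      Matrix.cons_val_three, Matrix.cons_val_four, Matrix.cons_val]
    push_cast
    ring
  have pack := WordLayer.sum_pack3 (layerThree ∪ gzLETwo) (Finset.univ : Finset (Fin 6))
    (fun j t => (cs j : ℝ) * WordLayer.gapF (ks j) β₀ β₁ γ₁ 1 a t) (fun j _ => WordLayer.gapF_smul_sa (cs j) (ks j) β₀ β₁ γ₁ 1 a)
    (fun j _ => (WordLayer.gapClass_integrableOn (ks j) (hadm j).1 (hadm j).2.1 (hadm j).2.2.1 (hadm j).2.2.2.1 (hadm j).2.2.2.2).const_mul _)
    (fun j _ s hs hsi => IH (cs j) (ks j) (hadm j).1 (hadm j).2.1 (hadm j).2.2.1 (hadm j).2.2.2.1 (hadm j).2.2.2.2 s hs hsi)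
  have hRint : IntegrableOn (WordLayer.layerF (WordLayer.toT (WordLayer.gR2Q (MvPolynomial.monomial κ q) 0 0 a)) β₀ β₁ γ₁ (0 + 1) a)
      (KZ.openOrderedSimplex 3) := by
    rw [Nat.zero_add]
    exact pack.2.1.congr_fun (fun z hz => (hsum z hz).symm) (measurableSet_simplex 3)
  have hR : ∀ s : KZ.IntegralRep 3, s.domain = simplex 3 →
      EqOn s.integrand (WordLayer.layerF (WordLayer.toT (WordLayer.gR2Q (MvPolynomial.monomial κ q) 0 0 a)) β₀ β₁ γ₁ (0 + 1) a) s.domain →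
      CongInto (layerThree ∪ gzLETwo) (KZ.of s) := by
    intro s hs hsi
    refine pack.2.2 s hs fun z hz => ?_
    have hz' : z ∈ KZ.openOrderedSimplex 3 := by rw [hs] at hz; exact hz
    rw [hsi hz, Nat.zero_add, hsum z hz']
  refine lowerT2G (MvPolynomial.monomial κ q) 0 β₀ β₁ γ₁ 0 a ha hRint hR r hd fun z hz => ?_
  rw [hi hz, WordLayer.layerF_toT_monomial]

end Summit.KontsevichZagierPeriods.KontsevichZagierPeriods.Cruxes.GZNormalFormWThree.GZLadder

/-! # §43  DUALITY FOR GAP CLASSES (decomp-kz lens-1 gen 11): `gapF κ B ∘ σ₃ = gapF κ^rev B^dual`, so the `GapClassMatch` clause for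
`(κ, B)` follows from the clause for `(κ∘rev, (γ₂,γ₁,β₁,β₀,α))`; the measure `μ` is duality-invariant, hence rules D3', D5', D6' (and
D7', D8', D9') of the decision list are the primal rules applied to the dual class — no separate proofs needed. -/

namespace Summit.KontsevichZagierPeriods.KontsevichZagierPeriods.Cruxes.GZNormalFormWThree.GZLadder

open Set MeasureTheory Literature.NumberTheory.Transcendental
open Summit.KontsevichZagierPeriods.RootDecompZetaThreeFrontier
open Summit.KontsevichZagierPeriods.KontsevichZagierPeriods.Theorems.RootDecompZetaThreeFrontierWordMoves (dualRep3 dualRep3_integrand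
  mem_simplex_three_duΦ)

/-- Auxiliary step `gapF_duΦ`. [bookkeeping] -/
theorem gapF_duΦ (κ : Fin 4 → ℕ) (β₀ β₁ γ₁ γ₂ α : ℕ) (t : Fin 3 → ℝ) :
    WordLayer.gapF κ β₀ β₁ γ₁ γ₂ α (Summit.KontsevichZagierPeriods.KontsevichZagierPeriods.Theorems.RootDecompZetaThreeFrontierWordMoves.duΦ t) =
      WordLayer.gapF (fun i => κ (Fin.rev i)) γ₂ γ₁ β₁ β₀ α t := by
  simp only [WordLayer.gapF, Summit.KontsevichZagierPeriods.KontsevichZagierPeriods.Theorems.RootDecompZetaThreeFrontierWordMoves.duΦ_zero,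
    Summit.KontsevichZagierPeriods.KontsevichZagierPeriods.Theorems.RootDecompZetaThreeFrontierWordMoves.duΦ_one,
    Summit.KontsevichZagierPeriods.KontsevichZagierPeriods.Theorems.RootDecompZetaThreeFrontierWordMoves.duΦ_two]
  have e0 : Fin.rev (0 : Fin 4) = 3 := rfl
  have e1 : Fin.rev (1 : Fin 4) = 2 := rfl
  have e2 : Fin.rev (2 : Fin 4) = 1 := rfl
  have e3 : Fin.rev (3 : Fin 4) = 0 := rfl
  simp only [e0, e1, e2, e3]
  ring

/-- **the `GapClassMatch` clause is self-dual**: the clause for `(κ, (β₀,β₁,γ₁,γ₂,α))` follows from the clause for the reflected class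
`(κ∘rev, (γ₂,γ₁,β₁,β₀,α))` (one σ₃ duality move). -/
theorem gapClass_of_dual (q : ℚ) (κ : Fin 4 → ℕ) (β₀ β₁ γ₁ γ₂ α : ℕ)
    (h : ∀ s : KZ.IntegralRep 3, s.domain = simplex 3 →
      EqOn s.integrand (fun t => (q : ℝ) * WordLayer.gapF (fun i => κ (Fin.rev i)) γ₂ γ₁ β₁ β₀ α t) s.domain → CongInto (layerThree ∪ gzLETwo) (KZ.of s))
    (r : KZ.IntegralRep 3) (hd : r.domain = simplex 3)
    (hi : EqOn r.integrand (fun t => (q : ℝ) * WordLayer.gapF κ β₀ β₁ γ₁ γ₂ α t) r.domain) :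
    CongInto (layerThree ∪ gzLETwo) (KZ.of r) := by
  refine congInto_of_dual _ r hd (h (dualRep3 r hd) rfl fun t ht => ?_)
  have ht' : Summit.KontsevichZagierPeriods.KontsevichZagierPeriods.Theorems.RootDecompZetaThreeFrontierWordMoves.duΦ t ∈ r.domain := by
    rw [hd]; exact mem_simplex_three_duΦ ht
  rw [dualRep3_integrand, hi ht']
  show (q : ℝ) * _ = (q : ℝ) * _
  rw [gapF_duΦ]

end Summit.KontsevichZagierPeriods.KontsevichZagierPeriods.Cruxes.GZNormalFormWThree.GZLadder

end
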